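import Summits.QuantumFields.YangMills.Theorems.BalabanUVNodesN16Eq42VsSymmetrisedLinear
import Summits.QuantumFields.BalabanUV.T4Continuum.Support.NE7BlockAverageContourGaugeAbelian
import HarnessLib

/-!
# YM-DAG node N16 (NE3), the located averaging pin (42) ↔ (0.4) — part 13: SAME BLOCKS, DIFFERENT BASE POINTS — the linearised (0.4) recipe
# ON THE RECORD's BLOCK PARTITION is an EXACT coarse gauge of (42), for every base offset, every field, with no curvature hypothesis;
# abelian fields: exactly a coarse gauge transformation, coarse plaquettes agree — a LOCATED CORRECTION of this lineage's first-order reading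

Cell `pub-ymgap`, width seat `pub-ymgap-dag-n16-w3` (director-ym №197 ∕ HUMAN RULING D-0149), generation 6; part 13 of the W1b lineage.
`--kind proof --supports stmt-QuantumFields-20544 --as helper` (K3⁷; count-neutral; 0 `def`).  `bears_on: R4∕N16`.

THE LOCATED POINT (first-hand, `Literature/…/Balaban1983to89/Setup.lean` :173 ∕ :178).  The record's (0.4) (`BlockAveraging.blockAvg`, over `Setup`) has
`blockOf x = ⌊x∕L⌋` coordinatewise — its blocks are the CORNER blocks `yL + [0,L)ᵈ` in integer labels — and base point `emb y = yL + (L−1)∕2`, the CENTRE of that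
same block; its base segment is the centre-to-centre line (`AveragingRT.axialAvg`).  The fold's (42) (`B7Prop1Explicit.bavg` at anchor `Lz`, block `Lz + [0,L)ᵈ`,
iterated by `rescale`) lives on the SAME partition with the CORNER as base point.  Parts 6–10 of this lineage modelled «centring» as the stencil over the SHIFTED
block `q − s + [0,L)ᵈ` at the SAME anchor `q` (part 6 header: «block average with stencil `{q − s + r}`») — a comparison ACROSS two block partitions; the first-moment ∕
contracted-curvature term `ι_sF` of parts 6–10 (v3 of `W3-PIN-ANATOMY.md`: «the only non-gauge first-order content of the pin») is the defect of THAT comparison.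
For the record's geometry the right comparison keeps the block and moves the BASE POINT by `s`, and then (this file):

 * §1 `asum_contour_sub_base`: two (42)∕(0.4)-type closed contours with DIFFERENT base points `p₁, p₂` but the SAME block point `x` (hence the same straight piece
   `[x, x+Le_κ]`) differ by `[near legs at p₁, p₂] − [far legs at p₁+Le_κ, p₂+Le_κ] − [base segments at p₁, p₂]` — the straight pieces cancel.
 * §2 ★★ `T04_sub_Tside_eq_coarseGrad` (any normed ring, every bond field `A`, every base offset `s ∈ ℤᵈ`, every `L ≥ 1`; NO curvature hypothesis, NO error
   term): the (0.4)-SHAPED linear coarse bond variable on the block `q + [0,L)ᵈ` with base point `q+s` — independent `(σ,σ′)`-symmetrised stars `permWord σ (r − s)`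
   from `q+s` to the block points `q+r` (lit-balaban's `B12ContourAverage253.permWord` = [Balaban1987RG1] p. 252's family `𝐆`), the transported segment `[x, x+Le_κ]`,
   the far stars from `q+s+Le_κ`, base segment `[q+s, q+s+Le_κ]` — MINUS (42)'s `Tside L A q κ` ([Balaban1985Averaging] (47)–(48), corner base point, tree
   contours) EQUALS `Λ_s(q) − Λ_s(q + L•e_κ)`, `Λ_s(p) = Σ_r L^{−d}•|Sym|⁻¹•Σ_σ [A_{p+s}(permWord σ (r−s)) − A_p(treeWord r)]` (displayed): both recipes are «own
   base-point potential + THE SAME straight block mean `L^{−d}Σ_{x∈B} A([x,x+Le_κ])`»; the base segments cancel exactly.  `s = 0` is part 4's corner-block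
   symmetrised recipe (then `Λ_0` is part 4's `XhatSym_sub_Xhat` right side read as a potential); `s = ((L−1)∕2)·𝟙` is the record's centre.
 * §3 (commutative complete normed ℂ-algebra, `W = e^A`, (42)'s loops in the ball of the logarithm) ★★ `expUnit_T04_eq_coarseGauge_bavg`:
   `e^{T04_s[A](q,κ)} = e^{Λ_s(q)} · V̄_c · (e^{Λ_s(q+Le_κ)})⁻¹` EXACTLY (`AbelianBlockAverage.bavg_expUnit`: `V̄_c = e^{Tside}`) — the shape `u(c₋)·V̄_c·u(c₊)⁻¹` of a
   COARSE GAUGE TRANSFORMATION ((45)); ★ `cplaq_expUnit_T04_eq`: the coarse PLAQUETTE variables of the two block-averaged fields AGREE EXACTLY (`cplaq_conj`).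

READING FOR N16 (honest; supersedes v3's headline and the VERDICT paragraph of part 12's header, same author).  At the linearised level and for abelian
exponential fields the WHOLE one-step pin (42) ↔ (0.4)-on-the-record's-partition — axis-order symmetrisation + base point corner→centre + base segment — is an
EXACT coarse pure gauge; in particular part 12's criterion clause (defect) («pointwise coarse-gauge equivalence to (43)») holds EXACTLY in the abelian one-step
model for the (0.4)-shaped recipe, not only for its permutation half, and gauge-invariant coarse observables of the two averaged fields coincide.  What separates
the record's (0.4) from (42) is therefore (i) NON-ABELIAN SECOND-ORDER terms only (parts 3∕5∕9∕11: `2ρ₂(ℓ,a)` in a local exponential gauge; the `(σ,σ′)`-independent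
double mean is not a thin-loop mean non-abelianly), (ii) iteration (43) of the one-step statement, and (iii) the reading divergences (d1)–(d3) of g0's `step04`.
Parts 6–10 remain correct theorems about RE-BLOCKING (shifting the partition against a fixed anchor), which is not the record's geometry.  Nothing here is
about minimisers; by part 12 the variational transfer would follow from (defect)+(cov) for the actual non-abelian iterated `step04`, which is NOT claimed.

HONEST FRAMING.  [folklore] finite-sum bookkeeping BY NAME over `B7Prop1Explicit` (`asum_append`, `asum_revWord'`, `revWord_seg`, `disp_*`, `Xhat_eq`,
`cplaq_conj`), lit-balaban's `B12ContourAverage253.permWord ∕ disp_permWord`, part 4 (`doubleMean_sub_const`), `AbelianBlockAverage.bavg_expUnit`,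
`NE7BlockAverageContourGaugeAbelian` (`expUnit_add`, `expUnit_sub`); 0 `def` (the (0.4)-shaped sums are DISPLAYED in every statement), 0 `sorry`; no printed
sentence is a hypothesis; nothing of [Balaban1985Averaging] ∕ [Balaban1987RG1] asserted beyond what the tree proves; no minimiser; K3⁷ stubs NOT touched; N16 ∕ NE3
NOT discharged; count-neutral (typed 28∕28 · discharged 5∕27 work-bound, A 5∕28 — unmoved).  One finite four-torus programme at fixed `ε` — the Yang–Mills mass
gap (Clay) is NOT proved by any of this; R4 closes the conditional finite-𝕋⁴ rung `BalabanLadder.UV` only; nothing continuum ∕ ℝ⁴ ∕ OS.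
-/

set_option autoImplicit false

open scoped BigOperators
open NormedSpace Finset

namespace Summit.QuantumFields.YangMills.BalabanUVNodes.N16Eq04SameBlocksBasePointGauge

open Literature.MathematicalPhysics.QuantumFieldTheory.Balaban1983to89
open B7Prop1Explicit
open B12ContourAverage253 (permWord disp_permWord)
open Summit.QuantumFields.BalabanUV.T4Continuum.AbelianBlockAverage (bavg_expUnit)
open Summit.QuantumFields.BalabanUV.T4Continuum.NE7BlockAverageContourGaugeAbelian (expUnit_add expUnit_sub)
open Summit.QuantumFields.YangMills.BalabanUVNodes.N16Eq42VsSymmetrisedLinear (doubleMean_sub_const)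

noncomputable section

variable {d : ℕ}

/-! ## §1 Two base points, one block point: the straight pieces cancel -/

section Linear

variable {𝔸 : Type*} [NormedRing 𝔸] [NormedAlgebra ℂ 𝔸]

omit [NormedAlgebra ℂ 𝔸] in
/-- **TWO BASE POINTS, SAME BLOCK POINT.**  For closed contours of the (42)∕(0.4) type `w ++ [L steps +κ] ++ reverse w′ ++ [L steps −κ]` read from base
points `p₁` and `p₂`, with near legs `w₁, w₂` ending at the SAME point (`p₁ + disp w₁ = p₂ + disp w₂`) and far legs `w₁′, w₂′` of the same displacements:
the difference of the two circulations is `[A_{p₁}(w₁) − A_{p₂}(w₂)] − [A_{p₁+Le_κ}(w₁′) − A_{p₂+Le_κ}(w₂′)] − [A_{p₁}(seg) − A_{p₂}(seg)]` — the transported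
segment `[x, x+Le_κ]` is common and cancels. [folklore] -/
theorem asum_contour_sub_base (A : Site d → Fin d → 𝔸) (p₁ p₂ : Site d) (κ : Fin d) (L : ℕ) {w₁ w₁' w₂ w₂' : List (Letter d)}
    (h₁ : disp w₁' = disp w₁) (h₂ : disp w₂' = disp w₂) (hx : p₁ + disp w₁ = p₂ + disp w₂) :
    asum A p₁ (w₁ ++ seg κ L ++ revWord w₁' ++ seg κ (-(L : ℤ))) - asum A p₂ (w₂ ++ seg κ L ++ revWord w₂' ++ seg κ (-(L : ℤ)))
      = (asum A p₁ w₁ - asum A p₂ w₂) - (asum A (p₁ + (L : ℤ) • e κ) w₁' - asum A (p₂ + (L : ℤ) • e κ) w₂')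
        - (asum A p₁ (seg κ L) - asum A p₂ (seg κ L)) := by
  -- the reversed far legs, read from where the straight piece ends
  have e₁ : asum A (p₁ + (disp w₁ + (L : ℤ) • e κ)) (revWord w₁') = -asum A (p₁ + (L : ℤ) • e κ) w₁' :=
    asum_revWord' A _ _ (by rw [h₁]; abel)
  have e₂ : asum A (p₂ + (disp w₂ + (L : ℤ) • e κ)) (revWord w₂') = -asum A (p₂ + (L : ℤ) • e κ) w₂' :=
    asum_revWord' A _ _ (by rw [h₂]; abel)
  -- the closing segments `[p + Le_κ → p]`
  have f₁ : asum A (p₁ + (disp w₁ + (L : ℤ) • e κ + -disp w₁')) (seg κ (-(L : ℤ))) = -asum A p₁ (seg κ L) := by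
    rw [← revWord_seg, h₁, show p₁ + (disp w₁ + (L : ℤ) • e κ + -disp w₁) = p₁ + disp (seg κ (L : ℤ)) by rw [disp_seg]; abel]
    exact asum_revWord' A _ _ rfl
  have f₂ : asum A (p₂ + (disp w₂ + (L : ℤ) • e κ + -disp w₂')) (seg κ (-(L : ℤ))) = -asum A p₂ (seg κ L) := by
    rw [← revWord_seg, h₂, show p₂ + (disp w₂ + (L : ℤ) • e κ + -disp w₂) = p₂ + disp (seg κ (L : ℤ)) by rw [disp_seg]; abel]
    exact asum_revWord' A _ _ rfl
  simp only [asum_append, disp_append, disp_seg, disp_revWord]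
  rw [e₁, e₂, f₁, f₂, hx]
  abel

/-! ## §2 The linearised (0.4) recipe on the record's partition minus (42)'s `Tside` is an exact coarse gradient -/

omit [NormedAlgebra ℂ 𝔸] in
/-- The block point is reached from both base points: `(q + s) + disp (permWord σ (r − s)) = q + disp (treeWord r)`. [folklore] -/
theorem basePoint_add_disp (q s : Site d) (σ : Equiv.Perm (Fin d)) (v : Site d) :
    q + s + disp (permWord σ (v - s)) = q + disp (treeWord v) := by
  rw [disp_permWord, disp_treeWord]; abel

/-- A block mean of a constant is the constant: `Σ_{r ∈ [0,L)ᵈ} L^{−d} • c = c` (`1 ≤ L`). [folklore] -/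
theorem sum_boxMean_const (L : ℕ) (hL : 1 ≤ L) (c : 𝔸) : ∑ _r : Fin d → Fin L, (((L : ℝ) ^ d)⁻¹) • c = c := by
  have hL0 : ((L : ℝ) ^ d) ≠ 0 := pow_ne_zero _ (by exact_mod_cast (by omega : L ≠ 0))
  rw [Finset.sum_const, Finset.card_univ, Fintype.card_fun, Fintype.card_fin, Fintype.card_fin, ← Nat.cast_smul_eq_nsmul ℝ,
    smul_smul, Nat.cast_pow, mul_inv_cancel₀ hL0, one_smul]

/-- A mean over the axis orders of a constant is the constant. [folklore] -/
theorem symMean_const (c : 𝔸) :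
    (((Fintype.card (Equiv.Perm (Fin d)) : ℝ))⁻¹) • ∑ _σ : Equiv.Perm (Fin d), c = c := by
  have hN : (Fintype.card (Equiv.Perm (Fin d)) : ℝ) ≠ 0 := by exact_mod_cast Fintype.card_ne_zero
  rw [Finset.sum_const, Finset.card_univ, ← Nat.cast_smul_eq_nsmul ℝ, smul_smul, inv_mul_cancel₀ hN, one_smul]

/-- **THE EXPONENTS**: the (0.4)-shaped linear EXPONENT with base offset `s` (displayed: block mean × independent double mean over the axis orders of the
circulation around `Γ^σ_{q+s→q+r} ∪ [q+r, q+r+Le_κ] ∪ (−Γ^{σ′}) ∪ (−[q+s, q+s+Le_κ])`) minus (42)'s `Xhat L A q κ` equals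
`[Λ_s(q) − Λ_s(q+Le_κ)] − [A_{q+s}(seg κ L) − A_q(seg κ L)]` — the coarse gradient of the base-point potential minus the difference of the two base
segments (which the full bond variables put back, `T04_sub_Tside_eq_coarseGrad`). [folklore] -/
theorem X04_sub_Xhat_eq (L : ℕ) (hL : 1 ≤ L) (A : Site d → Fin d → 𝔸) (q s : Site d) (κ : Fin d) :
    (∑ r : Fin d → Fin L, (((L : ℝ) ^ d)⁻¹) • ((((Fintype.card (Equiv.Perm (Fin d)) : ℝ) ^ 2)⁻¹) •
        ∑ σ : Equiv.Perm (Fin d), ∑ σ' : Equiv.Perm (Fin d),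
          asum A (q + s) (permWord σ (boxVec L r - s) ++ seg κ L ++ revWord (permWord σ' (boxVec L r - s)) ++ seg κ (-(L : ℤ)))))
      - Xhat L A q κ
      = ((∑ r : Fin d → Fin L, (((L : ℝ) ^ d)⁻¹) • ((((Fintype.card (Equiv.Perm (Fin d)) : ℝ))⁻¹) •
            ∑ σ : Equiv.Perm (Fin d), (asum A (q + s) (permWord σ (boxVec L r - s)) - asum A q (treeWord (boxVec L r)))))
        - ∑ r : Fin d → Fin L, (((L : ℝ) ^ d)⁻¹) • ((((Fintype.card (Equiv.Perm (Fin d)) : ℝ))⁻¹) •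
            ∑ σ : Equiv.Perm (Fin d), (asum A (q + (L : ℤ) • e κ + s) (permWord σ (boxVec L r - s))
              - asum A (q + (L : ℤ) • e κ) (treeWord (boxVec L r)))))
        - (asum A (q + s) (seg κ L) - asum A q (seg κ L)) := by
  -- (42)'s exponent plus the base-segment difference, written as a block mean of a per-point quantity
  have hX : Xhat L A q κ - (asum A (q + s) (seg κ L) - asum A q (seg κ L))
      = ∑ r : Fin d → Fin L, (((L : ℝ) ^ d)⁻¹) •
          (asum A q (gammaWord L κ (boxVec L r) ++ seg κ (-(L : ℤ))) - (asum A (q + s) (seg κ L) - asum A q (seg κ L))) := by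
    unfold Xhat
    simp only [smul_sub, Finset.sum_sub_distrib, sum_boxMean_const L hL]
  -- per block point: the double mean collapses (part 4's `doubleMean_sub_const`) after §1
  have hr : ∀ r : Fin d → Fin L,
      ((Fintype.card (Equiv.Perm (Fin d)) : ℝ) ^ 2)⁻¹ •
          (∑ σ : Equiv.Perm (Fin d), ∑ σ' : Equiv.Perm (Fin d),
            asum A (q + s) (permWord σ (boxVec L r - s) ++ seg κ L ++ revWord (permWord σ' (boxVec L r - s)) ++ seg κ (-(L : ℤ))))
        - (asum A q (gammaWord L κ (boxVec L r) ++ seg κ (-(L : ℤ))) - (asum A (q + s) (seg κ L) - asum A q (seg κ L)))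
      = (((Fintype.card (Equiv.Perm (Fin d)) : ℝ))⁻¹) • ∑ σ : Equiv.Perm (Fin d),
          ((asum A (q + s) (permWord σ (boxVec L r - s)) - asum A q (treeWord (boxVec L r)))
            - (asum A (q + (L : ℤ) • e κ + s) (permWord σ (boxVec L r - s))
                - asum A (q + (L : ℤ) • e κ) (treeWord (boxVec L r)))) := by
    intro r
    refine doubleMean_sub_const _ _ _ _ fun σ σ' => ?_
    have h := asum_contour_sub_base A (q + s) q κ L (w₁ := permWord σ (boxVec L r - s)) (w₁' := permWord σ' (boxVec L r - s))
      (w₂ := treeWord (boxVec L r)) (w₂' := treeWord (boxVec L r))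
      (by rw [disp_permWord, disp_permWord]) rfl (basePoint_add_disp q s σ (boxVec L r))
    rw [show q + s + (L : ℤ) • e κ = q + (L : ℤ) • e κ + s by abel, sub_eq_iff_eq_add] at h
    rw [gammaWord, sub_eq_iff_eq_add, h]
    abel
  -- assemble: move the base-segment difference to the left, merge the block sums, apply `hr` pointwise
  have key : (∑ r : Fin d → Fin L, (((L : ℝ) ^ d)⁻¹) • ((((Fintype.card (Equiv.Perm (Fin d)) : ℝ) ^ 2)⁻¹) •
        ∑ σ : Equiv.Perm (Fin d), ∑ σ' : Equiv.Perm (Fin d),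
          asum A (q + s) (permWord σ (boxVec L r - s) ++ seg κ L ++ revWord (permWord σ' (boxVec L r - s)) ++ seg κ (-(L : ℤ)))))
      - (Xhat L A q κ - (asum A (q + s) (seg κ L) - asum A q (seg κ L)))
      = (∑ r : Fin d → Fin L, (((L : ℝ) ^ d)⁻¹) • ((((Fintype.card (Equiv.Perm (Fin d)) : ℝ))⁻¹) •
            ∑ σ : Equiv.Perm (Fin d), (asum A (q + s) (permWord σ (boxVec L r - s)) - asum A q (treeWord (boxVec L r)))))
        - ∑ r : Fin d → Fin L, (((L : ℝ) ^ d)⁻¹) • ((((Fintype.card (Equiv.Perm (Fin d)) : ℝ))⁻¹) •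
            ∑ σ : Equiv.Perm (Fin d), (asum A (q + (L : ℤ) • e κ + s) (permWord σ (boxVec L r - s))
              - asum A (q + (L : ℤ) • e κ) (treeWord (boxVec L r)))) := by
    rw [hX]
    simp only [← Finset.sum_sub_distrib, ← smul_sub]
    exact Finset.sum_congr rfl fun r _ => by rw [hr r]
  rw [← key]
  abel

/-- **★★ SAME BLOCKS, DIFFERENT BASE POINTS: THE LINEARISED (0.4) RECIPE ON THE RECORD's PARTITION IS AN EXACT COARSE GAUGE OF (42).**  For every normed
ring, every bond field `A`, every `L ≥ 1`, every bond `(q, κ)` of the `L`-lattice and EVERY base offset `s ∈ ℤᵈ` (the record: `s = ((L−1)∕2)·𝟙`,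
`Setup.emb`), the (0.4)-shaped linear coarse bond variable `T04_s[A](q,κ)` — symmetrised stars from the base point `q+s` to the points of the block
`q + [0,L)ᵈ`, transported segment, far stars, PLUS the base segment `A([q+s, q+s+Le_κ])` (displayed) — and (42)'s `Tside L A q κ` ((47)–(48):
`Σ_x L^{−d} A(Γ_{c,x})`, corner base point) satisfy `T04_s − Tside = Λ_s(q) − Λ_s(q + L•e_κ)` with the SITE FUNCTION
`Λ_s(p) = Σ_r L^{−d}•|Sym|⁻¹•Σ_σ [A_{p+s}(permWord σ (r − s)) − A_p(treeWord r)]` (displayed): an EXACT COARSE GRADIENT — no curvature hypothesis, no error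
term.  (Both recipes are «base-point potential + the same straight block mean»; the base segments cancel.) [folklore] -/
theorem T04_sub_Tside_eq_coarseGrad (L : ℕ) (hL : 1 ≤ L) (A : Site d → Fin d → 𝔸) (q s : Site d) (κ : Fin d) :
    ((∑ r : Fin d → Fin L, (((L : ℝ) ^ d)⁻¹) • ((((Fintype.card (Equiv.Perm (Fin d)) : ℝ) ^ 2)⁻¹) •
        ∑ σ : Equiv.Perm (Fin d), ∑ σ' : Equiv.Perm (Fin d),
          asum A (q + s) (permWord σ (boxVec L r - s) ++ seg κ L ++ revWord (permWord σ' (boxVec L r - s)) ++ seg κ (-(L : ℤ)))))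
        + asum A (q + s) (seg κ L))
      - Tside L A q κ
      = (∑ r : Fin d → Fin L, (((L : ℝ) ^ d)⁻¹) • ((((Fintype.card (Equiv.Perm (Fin d)) : ℝ))⁻¹) •
            ∑ σ : Equiv.Perm (Fin d), (asum A (q + s) (permWord σ (boxVec L r - s)) - asum A q (treeWord (boxVec L r)))))
        - ∑ r : Fin d → Fin L, (((L : ℝ) ^ d)⁻¹) • ((((Fintype.card (Equiv.Perm (Fin d)) : ℝ))⁻¹) •
            ∑ σ : Equiv.Perm (Fin d), (asum A (q + (L : ℤ) • e κ + s) (permWord σ (boxVec L r - s))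
              - asum A (q + (L : ℤ) • e κ) (treeWord (boxVec L r)))) := by
  have h := X04_sub_Xhat_eq L hL A q s κ
  rw [Xhat_eq L hL, sub_eq_iff_eq_add] at h
  -- `X04 = [Λ(q) − Λ(q′) − (seg₁ − seg₂)] + (Tside − seg₂)`; substitute and cancel
  rw [h]
  abel

/-- **THE CORNER CASE `s = 0`** (part 4's symmetrised recipe on corner blocks, base point = corner): `T04_0 − Tside = Λ_0(q) − Λ_0(q+Le_κ)` with
`Λ_0(p) = Σ_r L^{−d}•|Sym|⁻¹•Σ_σ [A_p(permWord σ r) − A_p(treeWord r)]` — part 4's `XhatSym_sub_Xhat` READ AS A COARSE GRADIENT (cf. part 11 for one `σ`). [folklore] -/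
theorem T04_zero_sub_Tside_eq_coarseGrad (L : ℕ) (hL : 1 ≤ L) (A : Site d → Fin d → 𝔸) (q : Site d) (κ : Fin d) :
    ((∑ r : Fin d → Fin L, (((L : ℝ) ^ d)⁻¹) • ((((Fintype.card (Equiv.Perm (Fin d)) : ℝ) ^ 2)⁻¹) •
        ∑ σ : Equiv.Perm (Fin d), ∑ σ' : Equiv.Perm (Fin d),
          asum A q (permWord σ (boxVec L r) ++ seg κ L ++ revWord (permWord σ' (boxVec L r)) ++ seg κ (-(L : ℤ)))))
        + asum A q (seg κ L))
      - Tside L A q κ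
      = (∑ r : Fin d → Fin L, (((L : ℝ) ^ d)⁻¹) • ((((Fintype.card (Equiv.Perm (Fin d)) : ℝ))⁻¹) •
            ∑ σ : Equiv.Perm (Fin d), (asum A q (permWord σ (boxVec L r)) - asum A q (treeWord (boxVec L r)))))
        - ∑ r : Fin d → Fin L, (((L : ℝ) ^ d)⁻¹) • ((((Fintype.card (Equiv.Perm (Fin d)) : ℝ))⁻¹) •
            ∑ σ : Equiv.Perm (Fin d), (asum A (q + (L : ℤ) • e κ) (permWord σ (boxVec L r))
              - asum A (q + (L : ℤ) • e κ) (treeWord (boxVec L r)))) := by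
  have h := T04_sub_Tside_eq_coarseGrad L hL A q 0 κ
  simp only [add_zero, sub_zero] at h
  exact h

end Linear

/-! ## §3 Abelian fields: the (0.4)-shaped average is a coarse gauge transform of (42)'s; coarse plaquettes agree exactly -/

section Comm

variable {𝔸 : Type*} [NormedCommRing 𝔸] [NormedAlgebra ℂ 𝔸] [CompleteSpace 𝔸]

/-- **★★ ABELIAN: THE (0.4)-SHAPED BLOCK AVERAGE ON THE RECORD's PARTITION IS A COARSE GAUGE TRANSFORM OF (42)'s, EXACTLY.**  In a commutative complete
normed ℂ-algebra let `W = e^A` bondwise and let (42)'s loop sums at the bond `(q,κ)` lie in the ball of the logarithm (`AbelianBlockAverage.bavg_expUnit`: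
`V̄_c = e^{Tside}`; a flux bound `dL²φ < log 2` suffices, part 1 `loop_small_of_flux`).  Then for every base offset `s`
`e^{T04_s[A](q,κ)} = e^{Λ_s(q)} · V̄_c · (e^{Λ_s(q+Le_κ)})⁻¹` — the shape `u(c₋)·V̄_c·u(c₊)⁻¹` of a COARSE GAUGE TRANSFORMATION ([Balaban1985Averaging] (45); tree
`bavg_gaugeAct`).  Here `e^{T04_s}` is the abelian-exponential value of the (0.4)-shaped recipe (exp of its linear bond variable, the convention of part 4's
`bavgSym` statements). [folklore] -/
theorem expUnit_T04_eq_coarseGauge_bavg (L : ℕ) (hL : 1 ≤ L) (A : Site d → Fin d → 𝔸) (q s : Site d) (κ : Fin d)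
    (hsmall : ∀ r : Fin d → Fin L, ‖asum A q (gammaWord L κ (boxVec L r) ++ seg κ (-(L : ℤ)))‖ < Real.log 2) :
    expUnit ((∑ r : Fin d → Fin L, (((L : ℝ) ^ d)⁻¹) • ((((Fintype.card (Equiv.Perm (Fin d)) : ℝ) ^ 2)⁻¹) •
        ∑ σ : Equiv.Perm (Fin d), ∑ σ' : Equiv.Perm (Fin d),
          asum A (q + s) (permWord σ (boxVec L r - s) ++ seg κ L ++ revWord (permWord σ' (boxVec L r - s)) ++ seg κ (-(L : ℤ)))))
        + asum A (q + s) (seg κ L))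
      = expUnit (∑ r : Fin d → Fin L, (((L : ℝ) ^ d)⁻¹) • ((((Fintype.card (Equiv.Perm (Fin d)) : ℝ))⁻¹) •
            ∑ σ : Equiv.Perm (Fin d), (asum A (q + s) (permWord σ (boxVec L r - s)) - asum A q (treeWord (boxVec L r)))))
        * bavg L (fun y μ => expUnit (A y μ)) q κ
        * (expUnit (∑ r : Fin d → Fin L, (((L : ℝ) ^ d)⁻¹) • ((((Fintype.card (Equiv.Perm (Fin d)) : ℝ))⁻¹) •
            ∑ σ : Equiv.Perm (Fin d), (asum A (q + (L : ℤ) • e κ + s) (permWord σ (boxVec L r - s))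
              - asum A (q + (L : ℤ) • e κ) (treeWord (boxVec L r))))))⁻¹ := by
  rw [bavg_expUnit L hL A q κ hsmall, ← expUnit_add, ← expUnit_sub]
  congr 1
  have h := T04_sub_Tside_eq_coarseGrad L hL A q s κ
  rw [sub_eq_iff_eq_add] at h
  rw [h]
  abel

/-- **★ HENCE THE COARSE PLAQUETTE VARIABLES AGREE EXACTLY**: for every coarse plaquette `p′` (corner `z`, directions `μ, ν`) the plaquette variable of the
(0.4)-shaped abelian block-averaged field (base offset `s`, on the record's partition) equals that of (42)'s `V̄ = bavg L (e^A)` — at the gauge-invariant level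
the two averaging prescriptions COINCIDE on abelian fields (tree `cplaq_conj`, commutative).  (42)'s loops are taken in the ball of the logarithm at every
bond. [folklore] -/
theorem cplaq_expUnit_T04_eq (L : ℕ) (hL : 1 ≤ L) (A : Site d → Fin d → 𝔸) (s : Site d) (z : Site d) (μ ν : Fin d)
    (hsmall : ∀ (q : Site d) (κ : Fin d) (r : Fin d → Fin L), ‖asum A q (gammaWord L κ (boxVec L r) ++ seg κ (-(L : ℤ)))‖ < Real.log 2) :
    cplaq L (fun q κ => expUnit ((∑ r : Fin d → Fin L, (((L : ℝ) ^ d)⁻¹) • ((((Fintype.card (Equiv.Perm (Fin d)) : ℝ) ^ 2)⁻¹) •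
        ∑ σ : Equiv.Perm (Fin d), ∑ σ' : Equiv.Perm (Fin d),
          asum A (q + s) (permWord σ (boxVec L r - s) ++ seg κ L ++ revWord (permWord σ' (boxVec L r - s)) ++ seg κ (-(L : ℤ)))))
        + asum A (q + s) (seg κ L))) z μ ν
      = cplaq L (bavg L fun y m => expUnit (A y m)) z μ ν := by
  set u : Site d → 𝔸ˣ := fun p => expUnit (∑ r : Fin d → Fin L, (((L : ℝ) ^ d)⁻¹) •
    ((((Fintype.card (Equiv.Perm (Fin d)) : ℝ))⁻¹) •
      ∑ σ : Equiv.Perm (Fin d), (asum A (p + s) (permWord σ (boxVec L r - s)) - asum A p (treeWord (boxVec L r))))) with hu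
  have hb : ∀ (q : Site d) (κ : Fin d),
      expUnit ((∑ r : Fin d → Fin L, (((L : ℝ) ^ d)⁻¹) • ((((Fintype.card (Equiv.Perm (Fin d)) : ℝ) ^ 2)⁻¹) •
          ∑ σ : Equiv.Perm (Fin d), ∑ σ' : Equiv.Perm (Fin d),
            asum A (q + s) (permWord σ (boxVec L r - s) ++ seg κ L ++ revWord (permWord σ' (boxVec L r - s)) ++ seg κ (-(L : ℤ)))))
          + asum A (q + s) (seg κ L))
        = u q * bavg L (fun y m => expUnit (A y m)) q κ * (u (q + (L : ℤ) • e κ))⁻¹ :=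
    fun q κ => expUnit_T04_eq_coarseGauge_bavg L hL A q s κ (hsmall q κ)
  rw [cplaq_conj L u (bavg L fun y m => expUnit (A y m)) _ z μ ν (hb z μ) (hb _ ν) (hb _ μ) (hb z ν), mul_inv_cancel_comm]

end Comm

end

end Summit.QuantumFields.YangMills.BalabanUVNodes.N16Eq04SameBlocksBasePointGauge
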